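import Literature.Topology.FourManifolds.SlideReshapeLower2
import Literature.Topology.FourManifolds.RebuildLowerArchFormulas
import Literature.Topology.FourManifolds.K2Lite
import HarnessLib

/-!
# The band-coordinate lower track instantiated on a band core, and the reshaping isotopy

Topic `Literature/Topology/FourManifolds`; fact seat `provefact-IsStrictHandleSlide.isSurgery`
(R. C. Kirby, *The Topology of 4-Manifolds*, LNM 1374 (1989), Ch. I §4; remaining content: the
named fact (S) `Literature.Topology.FourManifolds.FramedLink.IsStrictHandleSlide.slideModel`).
For a band core `c` (`BandCore.lean`) the abstract track data of `K2Lite.lean` are instantiated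
with `a = alo + epsLo`, `b = tlo - epsLo`, `ε = epsLo`, `f = fLo`, `g = gLo`, lift `3/20`, plateau
gap `κ₀ = 1/2` reached at the height `h_pl = (fLo a + fLo (b - ε))/2`, landing step
`[fLo (b - ε/2) + 13/100, fLo (b - ε/2) + 14/100]` (inside the top of the lift), the slope
`m_s = 2 M_H / v_min` from a bound `M_H` of `Hh'` on the landing window and a lower bound `v_min` of
the abscissa speed on the landing levels (both from compactness), and any tip depth
`κ_D ≤ c.liteKmax`, landing width `εℓ ≤ κ_D/4`, bend width `u₁ ≤ κ_D`:

* `BandCore.k2lite` — the `K2LiteData` of the band core;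
* `BandCore.exists_ambientIsotopy_k2lite` — **the reshaping isotopy**: the hypotheses of
  `BandCore.exists_ambientIsotopy_lowerTrack'` (`SlideReshapeLower2.lean`) hold for its track
  `(X₁, H₁)`, so an ambient isotopy of `S³`, stationary off any open set containing the moving band
  points, carries the rebuilt attaching circle to the knot following `(X₁, H₁)` through the band
  on the lower inner interval and unchanged elsewhere.

## References

* R. C. Kirby, *The Topology of 4-Manifolds*, LNM 1374, Springer (1989), Ch. I §4. [Kirby1989]
-/

open scoped Manifold ContDiff Topology
open Set Real Filter Function

noncomputable section

namespace Literature.Topology.FourManifolds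

namespace BandCore

variable {A B : Knot} {avoid : Set (Metric.sphere (0 : EuclideanSpace ℝ (Fin 4)) 1)} (c : BandCore A B avoid)

/-! ### Height facts of the band core on the lower window -/

/-- On `[alo, tlo]`, `fLo ∈ [1/5, 3/10]`. [folklore] -/
theorem fLo_mem_window {t : ℝ} (ht : t ∈ Icc c.alo c.tlo) : c.fLo t ∈ Icc (1 / 5 : ℝ) (3 / 10) := by
  have hm := c.marks_lt
  have hmono := c.strictMonoOn_fLo.monotoneOn
  have ha : c.fLo c.alo = 1 / 5 := by
    rw [(c.fLo_eq_heightA ⟨hm.2.1.le, hm.2.2.1.le⟩).1, c.heightA_marks.1]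
  have hb : c.fLo c.tlo = 3 / 10 := by
    rw [(c.fLo_eq_heightA ⟨by linarith, le_rfl⟩).1, c.heightA_marks.2.1]
  constructor
  · rw [← ha]; exact hmono (show c.alo ∈ Iic _ by simp only [mem_Iic]; linarith)
      (show t ∈ Iic _ by simp only [mem_Iic]; linarith [ht.2]) ht.1
  · rw [← hb]; exact hmono (show t ∈ Iic _ by simp only [mem_Iic]; linarith [ht.2])
      (show c.tlo ∈ Iic _ by simp only [mem_Iic]; linarith) ht.2

/-- `fLo_lt_fLo` (auxiliary). [folklore] -/
theorem fLo_lt_fLo {s t : ℝ} (hst : s < t) (ht : t ≤ c.tlo) : c.fLo s < c.fLo t :=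
  c.strictMonoOn_fLo (show s ∈ Iic _ by simp only [mem_Iic]; linarith [c.marks_lt.2.2.2.1, c.marks_lt.2.2.2.2.1, c.marks_lt.2.2.2.2.2.1])
    (show t ∈ Iic _ by simp only [mem_Iic]; linarith [c.marks_lt.2.2.2.1, c.marks_lt.2.2.2.2.1, c.marks_lt.2.2.2.2.2.1]) hst

/-- `fLo_le_fLo` (auxiliary). [folklore] -/
theorem fLo_le_fLo {s t : ℝ} (hst : s ≤ t) (ht : t ≤ c.tlo) : c.fLo s ≤ c.fLo t := by
  rcases hst.eq_or_lt with h | h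
  · rw [h]
  · exact (c.fLo_lt_fLo h ht).le

/-- `psiInv (thetaB (7/20)) ≤ tlo - 2 epsLo`. [folklore] -/
theorem psiInv_le_landing : c.psiInv (c.thetaB (7 / 20)) ≤ c.tlo - c.epsLo - c.epsLo := by
  obtain ⟨hε, hε1, hε2⟩ := c.epsLo_bounds
  have h1 : c.thetaB (7 / 20) < c.thetaB (3 / 10) :=
    c.strictAntiOn_thetaB (by norm_num) (by norm_num) (by norm_num)
  have h2 : c.psi (c.tlo - c.epsLo - c.epsLo) = c.thetaB (1 / 5) - 2 * c.epsLo * c.lam := by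
    simp only [psi]; ring
  rw [← c.psiInv_psi (c.tlo - c.epsLo - c.epsLo)]
  exact (c.strictMono_psiInv.le_iff_le).2 (by rw [h2]; linarith)

/-- On the landing window `gLo ≤ 3/10`. [folklore] -/
theorem gLo_le_landing {t : ℝ} (ht : c.tlo - c.epsLo - c.epsLo ≤ t) : c.gLo t ≤ 3 / 10 := by
  obtain ⟨hε, hε1, hε2⟩ := c.epsLo_bounds
  have h0 := c.psiInv_le_landing
  have htlo := c.tlo_marksB
  have h1 : c.gLo t ≤ c.gLo (c.tlo - c.epsLo - c.epsLo) :=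
    c.strictAntiOn_gLo.antitoneOn (show c.tlo - c.epsLo - c.epsLo ∈ Ici _ from h0)
      (show t ∈ Ici _ from h0.trans ht) ht
  have h2 : c.gLo (c.tlo - c.epsLo - c.epsLo) = c.heightB (c.psi (c.tlo - c.epsLo - c.epsLo)) :=
    c.gLo_spec.2.1 _ ⟨h0, by linarith⟩
  have hpsi : c.psi (c.tlo - c.epsLo - c.epsLo) = c.thetaB (1 / 5) - 2 * c.epsLo * c.lam := by simp only [psi]; ring
  have hB15 : c.thetaB (1 / 5) ≤ c.thetaB 10⁻¹ := c.strictAntiOn_thetaB.antitoneOn (by norm_num) (by norm_num) (by norm_num)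
  have hB310 : c.thetaB (9 / 10) ≤ c.thetaB (3 / 10) := c.strictAntiOn_thetaB.antitoneOn (by norm_num) (by norm_num) (by norm_num)
  have h3 : c.heightB (c.psi (c.tlo - c.epsLo - c.epsLo)) ≤ c.heightB (c.thetaB (3 / 10)) := by
    apply c.strictAntiOn_heightB.antitoneOn
    · exact ⟨hB310, (c.strictAntiOn_thetaB (by norm_num) (by norm_num) (by norm_num : (10⁻¹ : ℝ) < 3 / 10)).le⟩
    · rw [hpsi]; exact ⟨by linarith, by nlinarith [c.lam_pos]⟩
    · rw [hpsi]; linarith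
  rw [c.heightB_thetaB (by norm_num)] at h3
  linarith

/-! ### The quantitative constants of the band core -/

/-- The virtual height of the lower track (before instantiation): `fLo + 3/20 · smoothStep`. [folklore] -/
def liteHh (t : ℝ) : ℝ := c.fLo t + 3 / 20 * smoothStep (c.tlo - c.epsLo - c.epsLo) (c.tlo - c.epsLo - c.epsLo / 2) t

/-- The lower landing level `h_r0 = fLo (tlo - 3 epsLo/2) + 13/100`. [folklore] -/
def liteHr0 : ℝ := c.fLo (c.tlo - c.epsLo - c.epsLo / 2) + 13 / 100

/-- The upper landing level `h_r1 = fLo (tlo - 3 epsLo/2) + 14/100`. [folklore] -/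
def liteHr1 : ℝ := c.fLo (c.tlo - c.epsLo - c.epsLo / 2) + 14 / 100

/-- `liteHr_lt` (auxiliary). [folklore] -/
theorem liteHr_lt : c.liteHr0 < c.liteHr1 := by rw [liteHr0, liteHr1]; linarith

/-- `continuous_liteHh` (auxiliary). [folklore] -/
theorem continuous_liteHh : Continuous c.liteHh :=
  c.fLo_spec.1.continuous.add (continuous_const.mul (continuous_smoothStep _ _))

/-- A bound of `Hh' = fLo' + 3/20 smoothStep'` on the landing window. [folklore] -/
theorem exists_liteMH : ∃ M : ℝ, ∀ t ∈ Icc (c.tlo - c.epsLo - c.epsLo) (c.tlo - c.epsLo + c.epsLo),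
    deriv c.fLo t + 3 / 20 * deriv (smoothStep (c.tlo - c.epsLo - c.epsLo) (c.tlo - c.epsLo - c.epsLo / 2)) t ≤ M := by
  have hc : Continuous (fun t ↦ deriv c.fLo t + 3 / 20 * deriv (smoothStep (c.tlo - c.epsLo - c.epsLo) (c.tlo - c.epsLo - c.epsLo / 2)) t) :=
    (c.fLo_spec.1.continuous_deriv (by simp)).add (continuous_const.mul ((contDiff_smoothStep _ _).continuous_deriv (by simp)))
  obtain ⟨M, hM⟩ := (isCompact_Icc.image hc).isBounded.bddAbove
  exact ⟨M, fun t ht ↦ hM (mem_image_of_mem _ ht)⟩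

/-- `liteMH` (auxiliary). [folklore] -/
def liteMH : ℝ := Classical.choose c.exists_liteMH

/-- `liteMH_spec` (auxiliary). [folklore] -/
theorem liteMH_spec : ∀ t ∈ Icc (c.tlo - c.epsLo - c.epsLo) (c.tlo - c.epsLo + c.epsLo),
    deriv c.fLo t + 3 / 20 * deriv (smoothStep (c.tlo - c.epsLo - c.epsLo) (c.tlo - c.epsLo - c.epsLo / 2)) t ≤ c.liteMH :=
  Classical.choose_spec c.exists_liteMH

/-- `liteMH_pos` (auxiliary). [folklore] -/
theorem liteMH_pos : 0 < c.liteMH := by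
  have hε := c.epsLo_pos'
  have hm := c.marks_lt
  have h1 : 0 < deriv c.fLo c.tlo := c.fLo_spec.2.2.1 c.tlo (by linarith)
  have h2 : 0 ≤ deriv (smoothStep (c.tlo - c.epsLo - c.epsLo) (c.tlo - c.epsLo - c.epsLo / 2)) c.tlo :=
    deriv_smoothStep_nonneg (by linarith) _
  have := c.liteMH_spec c.tlo ⟨by linarith, by linarith⟩
  linarith

/-- **A positive lower bound of the abscissa speed on the landing levels** `Sr ∈ [1/8, 7/8]`. [folklore] -/
theorem exists_liteVmin : ∃ v : ℝ, 0 < v ∧ ∀ t ∈ Icc (c.tlo - c.epsLo - c.epsLo) (c.tlo - c.epsLo - c.epsLo / 2),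
    smoothStep c.liteHr0 c.liteHr1 (c.liteHh t) ∈ Icc (8⁻¹ : ℝ) (7 / 8) →
    v ≤ deriv (smoothStep c.liteHr0 c.liteHr1) (c.liteHh t) * deriv c.fLo t := by
  have hε := c.epsLo_pos'
  have hm := c.marks_lt
  set F : ℝ → ℝ := fun t ↦ deriv (smoothStep c.liteHr0 c.liteHr1) (c.liteHh t) * deriv c.fLo t with hF
  have hFc : Continuous F :=
    (((contDiff_smoothStep _ _).continuous_deriv (by simp)).comp c.continuous_liteHh).mul
      (c.fLo_spec.1.continuous_deriv (by simp))
  set Z : Set ℝ := {t ∈ Icc (c.tlo - c.epsLo - c.epsLo) (c.tlo - c.epsLo - c.epsLo / 2) |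
    smoothStep c.liteHr0 c.liteHr1 (c.liteHh t) ∈ Icc (8⁻¹ : ℝ) (7 / 8)} with hZ
  have hZc : IsCompact Z := by
    refine isCompact_Icc.inter_right ?_
    exact isClosed_Icc.preimage ((continuous_smoothStep _ _).comp c.continuous_liteHh)
  -- `F > 0` on `Z`
  have hFpos : ∀ t ∈ Z, 0 < F t := by
    rintro t ⟨ht, hS⟩
    have hf : 0 < deriv c.fLo t := c.fLo_spec.2.2.1 t (by linarith [ht.2])
    have hin : c.liteHh t ∈ Ioo c.liteHr0 c.liteHr1 := by
      constructor
      · by_contra h; rw [smoothStep_of_le c.liteHr_lt (le_of_not_gt h)] at hS; norm_num at hS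
      · by_contra h; rw [smoothStep_of_ge c.liteHr_lt (le_of_not_gt h)] at hS; norm_num at hS
    exact mul_pos (deriv_smoothStep_pos c.liteHr_lt hin) hf
  by_cases hne : Z.Nonempty
  · obtain ⟨t₀, ht₀, hmin⟩ := hZc.exists_isMinOn hne hFc.continuousOn
    exact ⟨F t₀, hFpos t₀ ht₀, fun t ht hS ↦ hmin ⟨ht, hS⟩⟩
  · refine ⟨1, one_pos, fun t ht hS ↦ ?_⟩
    exact absurd ⟨t, ht, hS⟩ hne

/-- `liteVmin` (auxiliary). [folklore] -/
def liteVmin : ℝ := Classical.choose c.exists_liteVmin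

/-- `liteVmin_spec` (auxiliary). [folklore] -/
theorem liteVmin_spec : 0 < c.liteVmin ∧ ∀ t ∈ Icc (c.tlo - c.epsLo - c.epsLo) (c.tlo - c.epsLo - c.epsLo / 2),
    smoothStep c.liteHr0 c.liteHr1 (c.liteHh t) ∈ Icc (8⁻¹ : ℝ) (7 / 8) →
    c.liteVmin ≤ deriv (smoothStep c.liteHr0 c.liteHr1) (c.liteHh t) * deriv c.fLo t :=
  Classical.choose_spec c.exists_liteVmin

/-- `m_s = 2 M_H / v_min`: the slope of the bend after the tip. [folklore] -/
def liteMs : ℝ := 2 * c.liteMH / c.liteVmin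

/-- `liteMs_pos` (auxiliary). [folklore] -/
theorem liteMs_pos : 0 < c.liteMs := div_pos (by linarith [c.liteMH_pos]) c.liteVmin_spec.1

/-- `liteMs_mul` (auxiliary). [folklore] -/
theorem liteMs_mul : c.liteMs * c.liteVmin = 2 * c.liteMH := by
  rw [liteMs]; field_simp [c.liteVmin_spec.1.ne']

/-- **The largest admissible tip depth** `κ_max = min (1/8, 1/(101 m_s))`. [folklore] -/
def liteKmax : ℝ := min 8⁻¹ (101⁻¹ / c.liteMs)

/-- `liteKmax_pos` (auxiliary). [folklore] -/
theorem liteKmax_pos : 0 < c.liteKmax := lt_min (by norm_num) (div_pos (by norm_num) c.liteMs_pos)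
/-- `liteKmax_le` (auxiliary). [folklore] -/
theorem liteKmax_le : c.liteKmax ≤ 8⁻¹ := min_le_left _ _
/-- `liteKmax_le'` (auxiliary). [folklore] -/
theorem liteKmax_le' : c.liteKmax ≤ 101⁻¹ / c.liteMs := min_le_right _ _

/-! ### The track data of the band core -/

/-- **The band-coordinate lower track of the band core** with tip depth `κ_D`, landing width `εℓ`
and bend width `u₁`. [cite: Kirby1989, Ch. I §4] -/
def k2lite {κD εℓ u₁ : ℝ} (hκ : 0 < κD) (hκ' : κD ≤ c.liteKmax) (hε : 0 < εℓ) (hε' : 4 * εℓ ≤ κD)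
    (hu : 0 < u₁) (hu' : u₁ ≤ κD) : K2LiteData where
  a := c.alo + c.epsLo
  b := c.tlo - c.epsLo
  ε := c.epsLo
  f := c.fLo
  g := c.gLo
  ch := 3 / 20
  κ₀ := 2⁻¹
  hpl := (c.fLo (c.alo + c.epsLo) + c.fLo (c.tlo - c.epsLo - c.epsLo)) / 2
  hr0 := c.liteHr0
  hr1 := c.liteHr1
  κD := κD
  εℓ := εℓ
  u₁ := u₁
  ms := c.liteMs
  vmin := c.liteVmin
  MH := c.liteMH
  ε_pos := c.epsLo_pos'
  hab := by linarith [c.alo_add_lt_tlo_sub]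
  f_smooth := c.fLo_spec.1
  g_smooth := c.gLo_spec.1
  f_deriv_pos := fun t ht ↦ c.fLo_spec.2.2.1 t (by linarith [c.marks_lt.2.2.2.1, c.marks_lt.2.2.2.2.1, c.marks_lt.2.2.2.2.2.1])
  g_deriv_neg := fun t ht ↦ c.cLo_hyp.2.2.2 t (by linarith)
  ch_pos := by norm_num
  κ₀_pos := by norm_num
  κ₀_le := le_rfl
  hpl_gt := by
    have := c.fLo_lt_fLo (show c.alo + c.epsLo < c.tlo - c.epsLo - c.epsLo by linarith [c.alo_add_lt_tlo_sub, c.epsLo_pos'])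
      (by linarith [c.epsLo_pos'])
    linarith
  hpl_le := by
    have h1 := c.fLo_lt_fLo (show c.alo + c.epsLo < c.tlo - c.epsLo - c.epsLo by linarith [c.alo_add_lt_tlo_sub, c.epsLo_pos'])
      (by linarith [c.epsLo_pos'])
    have h2 := c.fLo_le_fLo (show c.tlo - c.epsLo - c.epsLo ≤ c.tlo - c.epsLo - c.epsLo / 2 by linarith [c.epsLo_pos'])
      (by linarith [c.epsLo_pos'])
    rw [liteHr0]; linarith
  hr0_gt := by
    have h2 := c.fLo_le_fLo (show c.tlo - c.epsLo - c.epsLo ≤ c.tlo - c.epsLo - c.epsLo / 2 by linarith [c.epsLo_pos'])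
      (by linarith [c.epsLo_pos'])
    rw [liteHr0]; linarith
  hr_lt := c.liteHr_lt
  hr1_le := by rw [liteHr1]; linarith
  κD_pos := hκ
  κD_le := by linarith [hκ'.trans c.liteKmax_le]
  κD_small := by linarith [hκ'.trans c.liteKmax_le]
  εℓ_pos := hε
  εℓ_le := hε'
  u₁_pos := hu
  u₁_le := hu'
  ms_pos := c.liteMs_pos
  vmin_pos := c.liteVmin_spec.1
  vmin_le := fun t ht hS ↦ c.liteVmin_spec.2 t ht (by
    have hk := hκ'.trans c.liteKmax_le
    have e : c.liteHh t = c.fLo t + 3 / 20 * smoothStep (c.tlo - c.epsLo - c.epsLo) (c.tlo - c.epsLo - c.epsLo / 2) t := rfl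
    rw [e]
    exact ⟨by linarith [hS.1], by linarith [hS.2]⟩)
  MH_ge := c.liteMH_spec
  ms_large := by rw [c.liteMs_mul]
  f_lo := fun t ht ↦ by
    have := (c.fLo_mem_window (t := t) ⟨by linarith [ht.1, c.epsLo_pos'], by linarith [ht.2]⟩).1
    linarith
  f_hi := fun t ht ↦ by
    have := (c.fLo_mem_window (t := t) ⟨by linarith [ht.1, c.epsLo_pos'], by linarith [ht.2]⟩).2
    linarith
  g_mem := fun t ht ↦ by
    have h := c.gLo_mem (t := t) (by linarith [ht.2, c.tlo_marksB.1])
    exact ⟨h.1, by linarith [h.2]⟩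
  gap := fun t ht ↦ by
    have hg := c.gLo_le_landing ht.1
    have hf := (c.fLo_mem_window (t := c.tlo - c.epsLo - c.epsLo / 2)
      ⟨by linarith [c.alo_add_lt_tlo_sub, c.epsLo_pos'], by linarith [c.epsLo_pos']⟩).1
    have hk : c.liteMs * κD ≤ 101⁻¹ := by
      have := hκ'.trans c.liteKmax_le'
      rw [le_div_iff₀ c.liteMs_pos] at this
      linarith
    rw [liteHr0]; linarith

section

variable {κD εℓ u₁ : ℝ} (hκ : 0 < κD) (hκ' : κD ≤ c.liteKmax) (hε : 0 < εℓ) (hε' : 4 * εℓ ≤ κD)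
  (hu : 0 < u₁) (hu' : u₁ ≤ κD)

/-- The abscissa of the arch is the `smoothStep a b` of the track data. [folklore] -/
theorem cLo_fst_eq (t : ℝ) :
    c.cLo t 0 = smoothStep (c.k2lite hκ hκ' hε hε' hu hu').a (c.k2lite hκ hκ' hε hε' hu hu').b t := by
  rw [c.cLo_apply_zero]; rfl

/-- The height of the arch is the `v` of the track data. [folklore] -/
theorem cLo_snd_eq_v (t : ℝ) : c.cLo t 1 = (c.k2lite hκ hκ' hε hε' hu hu').v t := by
  rw [c.cLo_apply_one, K2LiteData.v]
  have e1 : (c.k2lite hκ hκ' hε hε' hu hu').a + (c.k2lite hκ hκ' hε hε' hu hu').ε = c.alo + 2 * c.epsLo := by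
    show c.alo + c.epsLo + c.epsLo = _; ring
  have e2 : (c.k2lite hκ hκ' hε hε' hu hu').b - (c.k2lite hκ hκ' hε hε' hu hu').ε = c.tlo - 2 * c.epsLo := by
    show c.tlo - c.epsLo - c.epsLo = _; ring
  rw [e1, e2]; rfl

/-- **The reshaping isotopy of the lower arch along the band-coordinate track.** See the module
docstring. [cite: Kirby1989, Ch. I §4] -/
theorem exists_ambientIsotopy_k2lite (hAB : Disjoint (range ⇑A) (range ⇑B))
    {O : Set (Metric.sphere (0 : EuclideanSpace ℝ (Fin 4)) 1)} (hO : IsOpen O)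
    (hOsub : ∀ u ∈ Icc (0 : ℝ) 1, ∀ s ∈ Icc (c.alo + c.epsLo / 2) (c.tlo - c.epsLo / 4),
      c.band (pt2 ((1 - u) * c.cLo s 0 + u * (c.k2lite hκ hκ' hε hε' hu hu').X₁ s)
        ((1 - u) * c.cLo s 1 + u * (c.k2lite hκ hκ' hε hε' hu hu').H₁ s)) ∈ O) :
    ∃ (Θ : AmbientIsotopy (𝓡 3) (Metric.sphere (0 : EuclideanSpace ℝ (Fin 4)) 1)) (k₂ : Knot),
      (∀ t y, y ∉ O → Θ.toFun t y = y) ∧ Θ.toFun 1 ∘ ⇑(c.rebuild hAB) = ⇑k₂ ∧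
      (∀ s ∈ Icc (c.alo + c.epsLo / 2) (c.tlo - c.epsLo / 4),
        k₂ (circlePt s) = c.band (pt2 ((c.k2lite hκ hκ' hε hε' hu hu').X₁ s) ((c.k2lite hκ hκ' hε hε' hu hu').H₁ s))) ∧
      (∀ t ∈ Ico c.alo (c.alo + 1), t ∉ Icc (c.alo + c.epsLo / 2) (c.tlo - c.epsLo / 4) →
        k₂ (circlePt t) = c.rebuild hAB (circlePt t)) := by
  set d := c.k2lite hκ hκ' hε hε' hu hu' with hd
  have hε0 := c.epsLo_pos'
  have hab := c.alo_add_lt_tlo_sub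
  have ha : d.a = c.alo + c.epsLo := rfl
  have hb : d.b = c.tlo - c.epsLo := rfl
  have hεd : d.ε = c.epsLo := rfl
  have hI : ∀ {s}, s ∈ Icc (c.alo + c.epsLo / 2) (c.tlo - c.epsLo / 4) →
      s ∈ Icc (d.a - d.ε / 2) (d.b + 3 * d.ε / 4) := fun hs ↦ by
    rw [ha, hb, hεd]; exact ⟨by linarith [hs.1], by linarith [hs.2]⟩
  refine c.exists_ambientIsotopy_lowerTrack' hAB d.contDiff_X₁ d.contDiff_H₁ ?_ ?_ d.X₁_mem_Icc d.deriv_X₁_nonneg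
    ?_ ?_ ?_ ?_ ?_ ?_ ?_ ?_ hO hOsub
  · -- hagreeX
    intro t ht
    rcases le_or_gt t (c.alo + c.epsLo) with h | h
    · rw [d.X₁_of_le_a (by rw [ha]; exact h), c.cLo_fst_eq_zero_of_le h]
    · have h2 : c.tlo - c.epsLo / 2 ≤ t := by
        by_contra h2; exact ht ⟨h, lt_of_not_ge h2⟩
      rw [d.X₁_of_ge (by rw [hb, hεd]; linarith), c.cLo_fst_eq_one_of_ge (by linarith)]
  · -- hagreeH
    intro t ht
    rcases le_or_gt t (c.alo + c.epsLo) with h | h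
    · rw [d.H₁_of_le_a (by rw [ha]; exact h), c.cLo_snd_eq_fLo_of_le (by linarith)]; rfl
    · have h2 : c.tlo - c.epsLo / 2 ≤ t := by
        by_contra h2; exact ht ⟨h, lt_of_not_ge h2⟩
      rw [d.H₁_of_ge (by rw [hb, hεd]; linarith), c.cLo_snd_eq_gLo_of_ge (by linarith)]; rfl
  · -- hX₁zero
    intro s _ h0
    have := d.le_a_of_X₁_eq_zero h0
    rw [d.H₁_of_le_a this]; rfl
  · -- hX₁lt
    intro t ht
    exact d.X₁_lt_one_of_le (by rw [hb, hεd]; linarith)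
  · -- hH₁I
    intro t ht
    exact d.H₁_mem_Ioo (hI ht)
  · -- hH₁ge
    intro t ht hX
    exact d.g_le_H₁ (by rw [hb, hεd]; exact ⟨by linarith [ht.1], by linarith [ht.2]⟩) hX
  · -- hinj₁
    intro s hs t ht h
    apply d.injOn_track (hI hs) (hI ht)
    have h0 : d.X₁ s = d.X₁ t := by simpa using congrArg (fun p : EuclideanSpace ℝ (Fin 2) ↦ p 0) h
    have h1 : d.H₁ s = d.H₁ t := by simpa using congrArg (fun p : EuclideanSpace ℝ (Fin 2) ↦ p 1) h
    exact Prod.ext h0 h1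
  · -- hreg₁
    intro s hs hX
    exact d.deriv_H₁_ne_zero (hI hs) hX
  · -- hco
    intro t ht t' ht' hlt h0 _
    rw [c.cLo_fst_eq hκ hκ' hε hε' hu hu', c.cLo_fst_eq hκ hκ' hε hε' hu hu'] at h0
    have := d.co_mono (hI ht) (hI ht') hlt h0
    rw [c.cLo_snd_eq_v hκ hκ' hε hε' hu hu', c.cLo_snd_eq_v hκ hκ' hε hε' hu hu']
    exact this
  · -- hcoD
    intro s hs hχ' _
    have eχ : (fun t ↦ c.cLo t 0) = smoothStep d.a d.b := funext fun t ↦ c.cLo_fst_eq hκ hκ' hε hε' hu hu' t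
    have ev : (fun t ↦ c.cLo t 1) = d.v := funext fun t ↦ c.cLo_snd_eq_v hκ hκ' hε hε' hu hu' t
    rw [eχ] at hχ'
    rw [ev]
    exact d.co_monoD (hI hs) hχ'

end

end BandCore

end Literature.Topology.FourManifolds
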